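import Mathlib
import HarnessLib
import Summits.Ventures.LatticeQCDFlow.Scaling.AutoregressiveGaugeAcceptanceCeilingHalf
import Summits.Ventures.LatticeQCDFlow.Scaling.AutoregressiveGaugePlaquetteBallMass
import Summits.Ventures.LatticeQCDFlow.Scaling.AutoregressiveGaugeKLExtensiveStepFloor

/-!
# LatticeQCDFlow / Scaling — THE VOLUME LAW WITH THE SMALL-BALL CONSTANT: in every generation order of all
# links, an endpoint-blind autoregressive gauge model has training loss `≥ (d·#sites/4)·2u²` and drives an
# exact sampler with `τ_int(sign) ≥ exp((d·#sites/4)·2u²) − ½`, `1/κ ≥ exp((d·#sites/4)·2u²)`, for every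
# `u ≥ 0` below `π_β{‖ρ(U_p) − 1‖ ≤ ε} − Haar{‖ρ(g) − 1‖ ≤ ε}` — four times the plaquette-mean rate at weak
# coupling, every compact group, no central element

HONEST FRAMING: exact (Metropolis-corrected) sampling algorithms for lattice gauge theory;
figures of merit are autocorrelation/cost numbers at stated couplings and volumes; no
continuum-physics claim.

Venture `LatticeQCDFlow` (cell pub-lqcd), topic `Scaling`, FANOUT row 30 (lean-1, GEN-21) — OUR WORK on
THEORY-2.md §4 row C5: the SMALL-BALL INSTANCE of `Scaling/AutoregressiveGaugeKLExtensiveStepFloor` (the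
volume law from any per-link conditional-error floor `v·Z`) with the floor of
`Scaling/AutoregressiveGaugeAcceptanceCeilingHalf.wilson_condGap_ge_ball_of_mem`: a conditioner for a link
`e` blind to the other links at one endpoint of `e` has conditional `L¹` error
`≥ 2(π_β(B_ε) − φ_ρ(ε))·Z` whenever the other three links of a plaquette through `e` are in its context
(`B_ε = {‖ρ(g) − 1‖ ≤ ε}`, `φ_ρ(ε) = Haar(B_ε)`; any compact `G`, any continuous `ρ`, any `β`, any `ε`).
With `v = 2u`, `0 ≤ u ≤ π_β(B_ε) − φ_ρ(ε)`: `(d·#sites/4)·v²/2 = (d·#sites/4)·2u²`.  At weak coupling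
`π_β(B_ε) → 1` (Chebyshev on a plaquette floor, `Scaling/AutoregressiveGaugePlaquetteBallMass`) and
`φ_ρ(ε) → Haar{ρ = 1}` as `ε → 0`, so `u → 1` for faithful `ρ` on an infinite group: `2` nats per counted
link against the `½` of the plaquette-mean instance `Scaling/AutoregressiveGaugeKLExtensiveAllPlanes`.

## What is proved (all [ours]; continuous `ρ`, `L ≥ 2`, `d ≥ 2`, any real `β`, any `ε`; squeezed
normalised conditionals `q_a` not reading later links of the duplicate-free order `l` of ALL links, each `q_e`
blind to the other links at an endpoint `Y e` of `e`)

* §0 **`wilson_condGap_ge_floor_mul_of_ball`** — `u ≤ (1/Z)∫𝟙_{B_ε}(U_p)F dπ − φ_ρ(ε)`, `e` a link of `p`,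
  `s` off `p`, `q` blind at an endpoint of `e`: `(2u)·Z ≤ ∫ |A_sF − q·A_{insert e s}F| dπ`.
* §1 **`wilson_kl_arHybrid_ge_dim_mul_card_site_mul_two_sq_ball`** — `0 ≤ u ≤ (1/Z)∫𝟙_{B_ε}(U_p)F − φ_ρ(ε)`
  for every plaquette `p`: `(d·#sites/4)·(2u)²/2 ≤ KL(e^{−βS_W}/Z ‖ H_l)`;
  **`wilson_tauInt_sign_ge_exp_ball`**, **`wilson_invKish_ge_exp_ball`** — `exp((d·#sites/4)·(2u)²/2) − ½
  ≤ τ_int(g)` for every measurable balanced sign observable `g` of the exact sampler, `exp(…) ≤ 1/κ`.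
* §2 **`wilson_kl_arHybrid_ge_dim_mul_card_site_mul_two_sq_ball_of_floor`** (unitary `ρ`, `N ≥ 1`, `ε > 0`)
  — with `u = 1 − 2N(1 − w)/ε² − φ_ρ(ε) ≥ 0` for any common plaquette floor `w ≤ ⟨(1/N)Re tr U_p⟩_β`.

NOT CLAIMED: explicit small-ball masses (group-specific inputs); conditioners reading both endpoints.
No `def`, no `sorry`, nothing cited as a fact beyond the tree.
-/

noncomputable section

namespace Summit.Ventures.LatticeQCDFlow.Theory2.Autoregressive

open MeasureTheory Function Set
open Literature.MathematicalPhysics.QuantumFieldTheory Literature.MathematicalPhysics.QuantumLattice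
open Summit.Ventures.LatticeQCDFlow.Exactness Summit.Ventures.LatticeQCDFlow.Scoring
open scoped Matrix Matrix.Norms.Frobenius

section Wilson

variable {d L N : ℕ} {G : Type*} [Group G] [TopologicalSpace G] [IsTopologicalGroup G]
  [CompactSpace G] [SecondCountableTopology G] [MeasurableSpace G] [BorelSpace G] [NeZero L]
  (ρ : G →* Matrix (Fin N) (Fin N) ℂ)

/-! ## §0 The small-ball floor is a per-link floor -/

/-- **The small-ball mass as a per-link conditional-error floor.**  Continuous `ρ`, `L ≥ 2`, any `β`,
any `ε`; `u ≤ (1/Z)∫𝟙_{B_ε}(U_p)F dπ − Haar(B_ε)`; `e` a link of `p`, `s` a set of links off `p`; `q ≥ 0`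
bounded measurable, normalised in `e`, blind to the other links at an endpoint `y` of `e`.  Then
`(2u)·Z ≤ ∫ |A_sF − q·A_{insert e s}F| dπ`. [ours] -/
theorem wilson_condGap_ge_floor_mul_of_ball (hρ : Continuous ρ) (hL : 2 ≤ L) (β ε : ℝ)
    (p : Plaquette d L) {u : ℝ}
    (hu : u ≤ (∫ U, Set.indicator {g : G | ‖ρ g - 1‖ ≤ ε} (1 : G → ℝ)
            (plaquetteHolonomy U p.1 p.2.1.1 p.2.1.2) * Real.exp (-β * wilsonAction ρ U)
          ∂Measure.pi (fun _ : Edge d L => haarProbability G)) /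
        (∫ W, Real.exp (-β * wilsonAction ρ W) ∂Measure.pi (fun _ : Edge d L => haarProbability G)) -
        (haarProbability G).real {g : G | ‖ρ g - 1‖ ≤ ε})
    {e : Edge d L}
    (he : e ∈ ({(p.1, p.2.1.1), (p.1.shift p.2.1.1, p.2.1.2), (p.1.shift p.2.1.2, p.2.1.1), (p.1, p.2.1.2)} :
      Finset (Edge d L)))
    {s : Finset (Edge d L)}
    (hs : s ⊆ Finset.univ \
      {(p.1, p.2.1.1), (p.1.shift p.2.1.1, p.2.1.2), (p.1.shift p.2.1.2, p.2.1.1), (p.1, p.2.1.2)})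
    {q : GaugeConfig d L G → ℝ} (hqm : Measurable q) (hq0 : ∀ U, 0 ≤ q U) {Cq : ℝ} (hqb : ∀ U, q U ≤ Cq)
    (hq1 : ∀ U, ∫ v, q (update U e v) ∂(haarProbability G) = 1)
    {y : Site d L} (hy : e.1 = y ∨ e.1.shift e.2 = y)
    (hqB : ∀ e' : Edge d L, e'.1 = y ∨ e'.1.shift e'.2 = y → e' ≠ e →
      ∀ (U : GaugeConfig d L G) (v : G), q (update U e' v) = q U) :
    2 * u * (∫ W, Real.exp (-β * wilsonAction ρ W) ∂Measure.pi (fun _ : Edge d L => haarProbability G)) ≤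
      ∫ U, |coordAvg (haarProbability G) s (fun V : GaugeConfig d L G => Real.exp (-β * wilsonAction ρ V)) U -
          q U * coordAvg (haarProbability G) (insert e s)
            (fun V : GaugeConfig d L G => Real.exp (-β * wilsonAction ρ V)) U|
        ∂Measure.pi (fun _ : Edge d L => haarProbability G) := by
  set π := Measure.pi (fun _ : Edge d L => haarProbability G) with hπ
  set Z : ℝ := ∫ W, Real.exp (-β * wilsonAction ρ W) ∂π with hZ
  set Y : ℝ := ∫ U, Set.indicator {g : G | ‖ρ g - 1‖ ≤ ε} (1 : G → ℝ)
      (plaquetteHolonomy U p.1 p.2.1.1 p.2.1.2) * Real.exp (-β * wilsonAction ρ U) ∂π with hY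
  set φ : ℝ := (haarProbability G).real {g : G | ‖ρ g - 1‖ ≤ ε} with hφ
  have hZpos : 0 < Z :=
    integral_exp_pos (Literature.Probability.LatticeModels.integrable_of_continuous_compactSpace _
      (Real.continuous_exp.comp (continuous_const.mul (continuous_wilsonAction ρ hρ))))
  have hball := wilson_condGap_ge_ball_of_mem (d := d) (L := L) ρ hρ hL β ε p he hs hqm hq0 hqb hq1 hy hqB
  -- `u ≤ Y/Z − φ` gives `u Z ≤ Y − φ Z`
  have huZ : u * Z ≤ Y - φ * Z := by
    have h1 := mul_le_mul_of_nonneg_right hu hZpos.le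
    have e1 : (Y / Z - φ) * Z = Y - φ * Z := by field_simp
    rw [e1] at h1
    exact h1
  linarith

/-! ## §1 The volume law with the small-ball constant -/

/-- **THE VOLUME LAW FOR THE TRAINING LOSS, SMALL-BALL CONSTANT.**  `d ≥ 2`, `L ≥ 2`, continuous `ρ`, any
`β`, any `ε`; `0 ≤ u ≤ (1/Z)∫𝟙_{B_ε}(U_p)F dπ − Haar(B_ε)` for every plaquette `p`; squeezed normalised
conditionals; `l` a duplicate-free list of ALL links (any order), `q_a` not reading later links; every `q_e`
blind to the other links at an endpoint `Y e` of `e`.  Then `(d·#sites/4)·(2u)²/2 ≤ KL(e^{−βS_W}/Z ‖ H_l)`.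
[ours] -/
theorem wilson_kl_arHybrid_ge_dim_mul_card_site_mul_two_sq_ball (hd : 2 ≤ d) (hρ : Continuous ρ)
    (hL : 2 ≤ L) (β ε : ℝ) {u : ℝ} (hu0 : 0 ≤ u)
    (hu : ∀ p : Plaquette d L, u ≤ (∫ U, Set.indicator {g : G | ‖ρ g - 1‖ ≤ ε} (1 : G → ℝ)
            (plaquetteHolonomy U p.1 p.2.1.1 p.2.1.2) * Real.exp (-β * wilsonAction ρ U)
          ∂Measure.pi (fun _ : Edge d L => haarProbability G)) /
        (∫ W, Real.exp (-β * wilsonAction ρ W) ∂Measure.pi (fun _ : Edge d L => haarProbability G)) -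
        (haarProbability G).real {g : G | ‖ρ g - 1‖ ≤ ε})
    {q : Edge d L → GaugeConfig d L G → ℝ} (hqm : ∀ a, Measurable (q a)) {cq Cq : ℝ} (hcq : 0 < cq)
    (hqlo : ∀ a U, cq ≤ q a U) (hqhi : ∀ a U, q a U ≤ Cq)
    (hq1 : ∀ a U, ∫ v, q a (update U a v) ∂(haarProbability G) = 1)
    (l : List (Edge d L)) (hl : l.Nodup) (hall : ∀ e : Edge d L, e ∈ l)
    (hpw : l.Pairwise (fun a b => ∀ (U : GaugeConfig d L G) (v : G), q a (update U b v) = q a U))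
    (Y : Edge d L → Site d L) (hY : ∀ e : Edge d L, e.1 = Y e ∨ e.1.shift e.2 = Y e)
    (hqB : ∀ e e' : Edge d L, e'.1 = Y e ∨ e'.1.shift e'.2 = Y e → e' ≠ e →
      ∀ (U : GaugeConfig d L G) (v : G), q e (update U e' v) = q e U) :
    (d : ℝ) * Fintype.card (Site d L) / 4 * (2 * u) ^ 2 / 2 ≤
      ∫ U, Real.exp (-β * wilsonAction ρ U) /
            (∫ W, Real.exp (-β * wilsonAction ρ W) ∂Measure.pi (fun _ : Edge d L => haarProbability G)) *
          Real.log ((Real.exp (-β * wilsonAction ρ U) /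
              ∫ W, Real.exp (-β * wilsonAction ρ W) ∂Measure.pi (fun _ : Edge d L => haarProbability G)) /
            ((l.map fun b => q b U).prod *
                coordAvg (haarProbability G) l.toFinset
                  (fun V : GaugeConfig d L G => Real.exp (-β * wilsonAction ρ V)) U /
              ∫ W, Real.exp (-β * wilsonAction ρ W) ∂Measure.pi (fun _ : Edge d L => haarProbability G)))
        ∂Measure.pi (fun _ : Edge d L => haarProbability G) := by
  have hq0 : ∀ a U, 0 ≤ q a U := fun a U => hcq.le.trans (hqlo a U)
  have h2u : 0 ≤ 2 * u := by positivity
  exact wilson_kl_arHybrid_ge_dim_mul_card_site_div_four_mul_sq_of_floor (d := d) (L := L) ρ hd hρ β hqm hcq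
    hqlo hqhi hq1 l hl hall hpw h2u (fun p e he s hs =>
      wilson_condGap_ge_floor_mul_of_ball (d := d) (L := L) ρ hρ hL β ε p (hu p) he hs (hqm e) (hq0 e)
        (hqhi e) (hq1 e) (hY e) (hqB e))

/-- **`τ_int(g) ≥ exp((d·#sites/4)·(2u)²/2) − ½`** for every measurable balanced sign observable `g` of the
exact independence sampler, under the hypotheses of
`wilson_kl_arHybrid_ge_dim_mul_card_site_mul_two_sq_ball`. [ours] -/
theorem wilson_tauInt_sign_ge_exp_ball (hd : 2 ≤ d) (hρ : Continuous ρ)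
    (hL : 2 ≤ L) (β ε : ℝ) {u : ℝ} (hu0 : 0 ≤ u)
    (hu : ∀ p : Plaquette d L, u ≤ (∫ U, Set.indicator {g : G | ‖ρ g - 1‖ ≤ ε} (1 : G → ℝ)
            (plaquetteHolonomy U p.1 p.2.1.1 p.2.1.2) * Real.exp (-β * wilsonAction ρ U)
          ∂Measure.pi (fun _ : Edge d L => haarProbability G)) /
        (∫ W, Real.exp (-β * wilsonAction ρ W) ∂Measure.pi (fun _ : Edge d L => haarProbability G)) -
        (haarProbability G).real {g : G | ‖ρ g - 1‖ ≤ ε})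
    {q : Edge d L → GaugeConfig d L G → ℝ} (hqm : ∀ a, Measurable (q a)) {cq Cq : ℝ} (hcq : 0 < cq)
    (hqlo : ∀ a U, cq ≤ q a U) (hqhi : ∀ a U, q a U ≤ Cq)
    (hq1 : ∀ a U, ∫ v, q a (update U a v) ∂(haarProbability G) = 1)
    (l : List (Edge d L)) (hl : l.Nodup) (hall : ∀ e : Edge d L, e ∈ l)
    (hpw : l.Pairwise (fun a b => ∀ (U : GaugeConfig d L G) (v : G), q a (update U b v) = q a U))
    (Y : Edge d L → Site d L) (hY : ∀ e : Edge d L, e.1 = Y e ∨ e.1.shift e.2 = Y e)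
    (hqB : ∀ e e' : Edge d L, e'.1 = Y e ∨ e'.1.shift e'.2 = Y e → e' ≠ e →
      ∀ (U : GaugeConfig d L G) (v : G), q e (update U e' v) = q e U)
    {g : GaugeConfig d L G → ℝ} (hgm : Measurable g) (hg1 : ∀ U, g U ^ 2 = 1)
    (hg0 : ∫ U, g U * Real.exp (-β * wilsonAction ρ U) ∂Measure.pi (fun _ : Edge d L => haarProbability G) = 0) :
    Real.exp ((d : ℝ) * Fintype.card (Site d L) / 4 * (2 * u) ^ 2 / 2) - 1 / 2 ≤
      tauInt (fun k => (∫ U, g U * ((imhOp (Measure.pi fun _ : Edge d L => haarProbability G)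
          (fun V : GaugeConfig d L G => Real.exp (-β * wilsonAction ρ V))
          (fun V : GaugeConfig d L G => (l.map fun b => q b V).prod *
              coordAvg (haarProbability G) l.toFinset
                (fun V' : GaugeConfig d L G => Real.exp (-β * wilsonAction ρ V')) V /
            ∫ W, Real.exp (-β * wilsonAction ρ W) ∂Measure.pi (fun _ : Edge d L => haarProbability G)))^[k]
            g) U * Real.exp (-β * wilsonAction ρ U) ∂Measure.pi (fun _ : Edge d L => haarProbability G)) /
          ∫ U, g U ^ 2 * Real.exp (-β * wilsonAction ρ U) ∂Measure.pi (fun _ : Edge d L => haarProbability G)) := by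
  have hq0 : ∀ a U, 0 ≤ q a U := fun a U => hcq.le.trans (hqlo a U)
  have h2u : 0 ≤ 2 * u := by positivity
  exact wilson_tauInt_sign_ge_exp_of_floor (d := d) (L := L) ρ hd hρ β hqm hcq hqlo hqhi hq1 l hl hall hpw h2u
    (fun p e he s hs =>
      wilson_condGap_ge_floor_mul_of_ball (d := d) (L := L) ρ hρ hL β ε p (hu p) he hs (hqm e) (hq0 e)
        (hqhi e) (hq1 e) (hY e) (hqB e)) hgm hg1 hg0

/-- **`1/κ ≥ exp((d·#sites/4)·(2u)²/2)`** — Kish fraction `≤ exp(−(d·#sites/4)·2u²)`. [ours] -/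
theorem wilson_invKish_ge_exp_ball (hd : 2 ≤ d) (hρ : Continuous ρ)
    (hL : 2 ≤ L) (β ε : ℝ) {u : ℝ} (hu0 : 0 ≤ u)
    (hu : ∀ p : Plaquette d L, u ≤ (∫ U, Set.indicator {g : G | ‖ρ g - 1‖ ≤ ε} (1 : G → ℝ)
            (plaquetteHolonomy U p.1 p.2.1.1 p.2.1.2) * Real.exp (-β * wilsonAction ρ U)
          ∂Measure.pi (fun _ : Edge d L => haarProbability G)) /
        (∫ W, Real.exp (-β * wilsonAction ρ W) ∂Measure.pi (fun _ : Edge d L => haarProbability G)) -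
        (haarProbability G).real {g : G | ‖ρ g - 1‖ ≤ ε})
    {q : Edge d L → GaugeConfig d L G → ℝ} (hqm : ∀ a, Measurable (q a)) {cq Cq : ℝ} (hcq : 0 < cq)
    (hqlo : ∀ a U, cq ≤ q a U) (hqhi : ∀ a U, q a U ≤ Cq)
    (hq1 : ∀ a U, ∫ v, q a (update U a v) ∂(haarProbability G) = 1)
    (l : List (Edge d L)) (hl : l.Nodup) (hall : ∀ e : Edge d L, e ∈ l)
    (hpw : l.Pairwise (fun a b => ∀ (U : GaugeConfig d L G) (v : G), q a (update U b v) = q a U))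
    (Y : Edge d L → Site d L) (hY : ∀ e : Edge d L, e.1 = Y e ∨ e.1.shift e.2 = Y e)
    (hqB : ∀ e e' : Edge d L, e'.1 = Y e ∨ e'.1.shift e'.2 = Y e → e' ≠ e →
      ∀ (U : GaugeConfig d L G) (v : G), q e (update U e' v) = q e U) :
    Real.exp ((d : ℝ) * Fintype.card (Site d L) / 4 * (2 * u) ^ 2 / 2) ≤
      (∫ U, Real.exp (-β * wilsonAction ρ U) /
            ((l.map fun b => q b U).prod *
                coordAvg (haarProbability G) l.toFinset
                  (fun V : GaugeConfig d L G => Real.exp (-β * wilsonAction ρ V)) U /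
              ∫ W, Real.exp (-β * wilsonAction ρ W) ∂Measure.pi (fun _ : Edge d L => haarProbability G)) *
          Real.exp (-β * wilsonAction ρ U) ∂Measure.pi (fun _ : Edge d L => haarProbability G)) /
        (∫ W, Real.exp (-β * wilsonAction ρ W) ∂Measure.pi (fun _ : Edge d L => haarProbability G)) ^ 2 := by
  have hq0 : ∀ a U, 0 ≤ q a U := fun a U => hcq.le.trans (hqlo a U)
  have h2u : 0 ≤ 2 * u := by positivity
  exact wilson_invKish_ge_exp_of_floor (d := d) (L := L) ρ hd hρ β hqm hcq hqlo hqhi hq1 l hl hall hpw h2u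
    (fun p e he s hs =>
      wilson_condGap_ge_floor_mul_of_ball (d := d) (L := L) ρ hρ hL β ε p (hu p) he hs (hqm e) (hq0 e)
        (hqhi e) (hq1 e) (hY e) (hqB e))

/-! ## §2 From a plaquette floor, by Chebyshev -/

/-- **The volume law with the small-ball constant from a plaquette floor** (unitary `ρ`, `N ≥ 1`, `ε > 0`):
with `w ≤ ⟨(1/N)Re tr U_p⟩_β` for every plaquette and `u = 1 − 2N(1 − w)/ε² − φ_ρ(ε) ≥ 0`:
`(d·#sites/4)·(2u)²/2 ≤ KL(e^{−βS_W}/Z ‖ H_l)`. [ours] -/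
theorem wilson_kl_arHybrid_ge_dim_mul_card_site_mul_two_sq_ball_of_floor (hd : 2 ≤ d) (hN : 1 ≤ N)
    (hρ : Continuous ρ) (hρU : ∀ g, ρ g ∈ Matrix.unitaryGroup (Fin N) ℂ) (hL : 2 ≤ L) (β : ℝ)
    {ε : ℝ} (hε : 0 < ε) {w : ℝ}
    (hw : ∀ p : Plaquette d L, w ≤ wilsonExpectation ρ β
      (fun U : GaugeConfig d L G => (N : ℝ)⁻¹ * (ρ (plaquetteHolonomy U p.1 p.2.1.1 p.2.1.2)).trace.re))
    (hu0 : 0 ≤ 1 - 2 * N * (1 - w) / ε ^ 2 - (haarProbability G).real {g : G | ‖ρ g - 1‖ ≤ ε})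
    {q : Edge d L → GaugeConfig d L G → ℝ} (hqm : ∀ a, Measurable (q a)) {cq Cq : ℝ} (hcq : 0 < cq)
    (hqlo : ∀ a U, cq ≤ q a U) (hqhi : ∀ a U, q a U ≤ Cq)
    (hq1 : ∀ a U, ∫ v, q a (update U a v) ∂(haarProbability G) = 1)
    (l : List (Edge d L)) (hl : l.Nodup) (hall : ∀ e : Edge d L, e ∈ l)
    (hpw : l.Pairwise (fun a b => ∀ (U : GaugeConfig d L G) (v : G), q a (update U b v) = q a U))
    (Y : Edge d L → Site d L) (hY : ∀ e : Edge d L, e.1 = Y e ∨ e.1.shift e.2 = Y e)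
    (hqB : ∀ e e' : Edge d L, e'.1 = Y e ∨ e'.1.shift e'.2 = Y e → e' ≠ e →
      ∀ (U : GaugeConfig d L G) (v : G), q e (update U e' v) = q e U) :
    (d : ℝ) * Fintype.card (Site d L) / 4 *
        (2 * (1 - 2 * N * (1 - w) / ε ^ 2 - (haarProbability G).real {g : G | ‖ρ g - 1‖ ≤ ε})) ^ 2 / 2 ≤
      ∫ U, Real.exp (-β * wilsonAction ρ U) /
            (∫ W, Real.exp (-β * wilsonAction ρ W) ∂Measure.pi (fun _ : Edge d L => haarProbability G)) *
          Real.log ((Real.exp (-β * wilsonAction ρ U) /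
              ∫ W, Real.exp (-β * wilsonAction ρ W) ∂Measure.pi (fun _ : Edge d L => haarProbability G)) /
            ((l.map fun b => q b U).prod *
                coordAvg (haarProbability G) l.toFinset
                  (fun V : GaugeConfig d L G => Real.exp (-β * wilsonAction ρ V)) U /
              ∫ W, Real.exp (-β * wilsonAction ρ W) ∂Measure.pi (fun _ : Edge d L => haarProbability G)))
        ∂Measure.pi (fun _ : Edge d L => haarProbability G) :=
  wilson_kl_arHybrid_ge_dim_mul_card_site_mul_two_sq_ball (d := d) (L := L) ρ hd hρ hL β ε hu0
    (fun p => by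
      have h := wilson_ball_mass_ge_of_floor (d := d) (L := L) ρ hN hρ hρU β hε p (hw p)
      linarith)
    hqm hcq hqlo hqhi hq1 l hl hall hpw Y hY hqB

end Wilson

end Summit.Ventures.LatticeQCDFlow.Theory2.Autoregressive

end
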